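import Summits.CriticalPhenomena.PercolationContinuityZ3.Theorems.PercNearOneGluingNoHeavyQuantGluedWindowHeavyTopI
import Summits.CriticalPhenomena.PercolationContinuityZ3.Theorems.PercNearOneGluingNoHeavyQuantGluedWindowTopCompAdv
import HarnessLib

/-!
# QUANT lane R8, T-DEC: LEMMA W's pair condition — the HEAVY-TOP / LIGHT-MIDDLE cell of the two-row regime (h a mid, both rows light into h, the bottom copy of
# `l` heavy for the top copy `A`, the middle copy LIGHT for `A`) PROVED WITHOUT THE CONJECTURE by the structured certificate "row `l+r` into `A` (it always fits),
# row `l` takes the rest of `A` and every copy of `h`" — no branch condition (arm-1 gen 61, architect)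

builds on p205010 (kernel theorem, internal audit signed; external expert review pending)

Support file (`--supports stmt-CriticalPhenomena-4575`), QUANT lane seat prim-quant-arm-1 (gen 61, architect); memo
`run/shared/lean/prim/quant/prim-quant-arm-1-g61/ARCH-G61.md` §1–§3.  Theorems only; standard axioms, no sorries, no definitions.

THE CELL.  Band frame and price system of `gluedPullback_windowPair_of_lemmaW`; light window pair `(l, h)` below a cheap atom `c ≥ h`; the two-row regime with
`h` a mid (`2(l+r) < T ≤ 2(l+r+k)`, `l+r+k ≤ j`, `T ≤ 2h`), the pair still LIGHT at the glued target (`T − 2l ≤ y(h−l)`), the bottom copy of `l` compatible with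
(hence heavy for) the top copy `A = l+r+k` (`T < 2l+r+k`; exact heavy power `ϖ_A = (2l+r+k−T)/(T−2l)`) and the middle copy LIGHT for `A` (`T − 2(l+r) ≤ yk`;
the largest h-mid family of the scale-free census, memo §1).  STRUCTURED CERTIFICATE: the middle copy's light power into `A` is at least `ϖ_B′ = (1−y)/G_A`
(`G_A = y² + (1−y)(T−2l−2r)/k ≤ y`), and `t₂ϖ_B′ ≥ t₂(1−y)/y ≥ 1 − y ≥ t₁`: row `l+r` ALWAYS fits into `A` — share `θ₁ = t₁/(t₂ϖ_B′)` of `A`, nothing else; row `l`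
takes the rest `1−θ₁` of `A` and ALL of every copy of `h` (exact light power `ϖ_a` of `(l,h)`).  The one inequality left, `(1−γ)(t₀ − t₂ϖ_A + t₁ϖ_A/ϖ_B′) ≤ γϖ_a`,
is in Z-form (★L) `Y/c + (1−y)(1−Y) ≤ 1/(c + t₁ε + t₂κ)`, `Y = t₀ − t₂(κ−ν)/ν + t₁((κ−ν)/ν)(y² + (1−y)(ν−2ε)/(κ−ε))/(1−y)` (`ν = N/d = 1+y−c`, `ε = r/d`,
`κ = (r+k)/d`), whose cleared form `heavyTopL_poly` (`…QuantGluedWindowHeavyTopLPoly`) is replayed from an exact Handelman certificate (kit j305229).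
**`gluedPullback_windowPair_twoRow_heavyTopL`**.  With `…HeavyTopI` / `…HeavyTopIIH` (middle copy heavy) and `…LightInc` (bottom copy incompatible) this closes
the h-mid configurations of LEMMA W in which both rows are light into `h`.

HONEST STATUS.  `GluedLemmaW` (flow form), `GluedDominatedMass`, the band, `SiblingStep`, `FarTreeRow` OPEN; RATE class (log\*) / honest sentence of
`run/shared/lean/prim/quant/README.md` unchanged.  [this work].  Nothing here is cited as a published result.  The gluing rows served
[cite: KozmaNitzan2024, Conjecture 3 (p. 15)]; product measure [cite: Grimmett1999, §1.3 p. 10].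
-/

set_option maxHeartbeats 4000000

noncomputable section

namespace Summit.CriticalPhenomena.PercolationContinuityZ3.Theorems
namespace Quant
namespace LawDec

/-- **THE HEAVY-TOP / LIGHT-MIDDLE CELL OF THE TWO-ROW REGIME (h a mid)**: `T − 2l ≤ y(h − l)` (the pair is light at the glued target), `T < 2l + r + k`
(the bottom copy of `l` can use the top copy) and `T − 2(l+r) ≤ yk` (the middle copy is light for the top copy) ⟹ `(1−γ)Ψ(l) + γΨ(h) ≤ 0` for every price system
and every cheap `c ≥ h` — no `GluedLemmaW`, no branch condition. [this work] -/
theorem gluedPullback_windowPair_twoRow_heavyTopL (x a q g S : ℝ) (B r k j l h c ls : ℕ) (α p : ℕ → ℝ)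
    (hx0 : 0 < x) (hx1 : x < 1) (ha0 : 0 < a) (ha1 : a ≤ 1) (hq0 : 0 < q) (hq1 : q < 1) (hg0 : 0 ≤ g) (hg1 : g ≤ 1) (hr : 1 ≤ r) (hk : 1 ≤ k)
    (hxqg : x ≤ q * g)
    (hlh : l < h) (hhB : h ≤ B) (hhj : h ≤ j) (hwin : j < h + r + k) (hlow : 2 * (l : ℝ) < a * S) (hcomp : a * S < (l : ℝ) + h)
    (hlight : pairGate (a * x) (a * S) l h < a * x)
    (hL2j : l + r + k ≤ j) (hL2mid : a * (S + q * ((r : ℝ) + k * g)) ≤ 2 * ((l : ℝ) + r + k))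
    (hL1low : 2 * ((l : ℝ) + r) < a * (S + q * ((r : ℝ) + k * g))) (hhmid : a * (S + q * ((r : ℝ) + k * g)) ≤ 2 * (h : ℝ))
    (hAcomp : a * (S + q * ((r : ℝ) + k * g)) < 2 * (l : ℝ) + r + k)
    (hBlight : a * (S + q * ((r : ℝ) + k * g)) - 2 * ((l : ℝ) + r) ≤ (a * x) * (k : ℝ))
    (hlightT : a * (S + q * ((r : ℝ) + k * g)) - 2 * (l : ℝ) ≤ (a * x) * ((h : ℝ) - l))
    (hhc : h ≤ c) (hcB : c ≤ B) (hcj : c ≤ j)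
    (hp : ∀ h, 0 ≤ p h)
    (hαp : ∀ l' h', l' ≤ j → 2 * (l' : ℝ) < a * (S + q * ((r : ℝ) + k * g)) → h' ≤ B + (r + k) →
      (j + 1 ≤ h' ∨ a * (S + q * ((r : ℝ) + k * g)) < (l' : ℝ) + h') →
      α l' ≤ usage (a * x) (a * (S + q * ((r : ℝ) + k * g))) j l' h' * p h')
    (hcheap : -(gluedPullback (a * (S + q * ((r : ℝ) + k * g))) q g j r k α p c) * (a * x)
      < (1 - a * x) * gluedPullback (a * (S + q * ((r : ℝ) + k * g))) q g j r k α p ls) :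
    (1 - pairGate (a * x) (a * S) l h) * gluedPullback (a * (S + q * ((r : ℝ) + k * g))) q g j r k α p l
      + pairGate (a * x) (a * S) l h * gluedPullback (a * (S + q * ((r : ℝ) + k * g))) q g j r k α p h ≤ 0 := by
  -- names (no `set`: the reduction theorem is applied to the original expressions at the end)
  obtain ⟨y, hy⟩ : ∃ y : ℝ, y = a * x := ⟨_, rfl⟩
  obtain ⟨T, hT⟩ : ∃ T : ℝ, T = a * (S + q * ((r : ℝ) + k * g)) := ⟨_, rfl⟩
  obtain ⟨T₀, hT₀⟩ : ∃ T₀ : ℝ, T₀ = a * S := ⟨_, rfl⟩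
  have hy0 : 0 < y := by rw [hy]; exact mul_pos ha0 hx0
  have hyx : y ≤ x := by rw [hy]; nlinarith
  have hy1 : y < 1 := by linarith
  have h1y : 0 < 1 - y := by linarith
  obtain ⟨t1, ht1⟩ : ∃ t1 : ℝ, t1 = q * (1 - g) := ⟨_, rfl⟩
  obtain ⟨t2, ht2⟩ : ∃ t2 : ℝ, t2 = q * g := ⟨_, rfl⟩
  have ht1p : 0 ≤ t1 := by rw [ht1]; exact mul_nonneg hq0.le (by linarith)
  have ht2p : 0 ≤ t2 := by rw [ht2]; exact mul_nonneg hq0.le hg0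
  have ht0p : 0 ≤ 1 - t1 - t2 := by
    rw [ht1, ht2, show 1 - q * (1 - g) - q * g = 1 - q by ring]; linarith
  have hyt2 : y ≤ t2 := by rw [ht2]; linarith
  have hr1 : (1:ℝ) ≤ r := by exact_mod_cast hr
  have hk1 : (1:ℝ) ≤ k := by exact_mod_cast hk
  have hr0 : (0:ℝ) ≤ r := by linarith
  have hk0 : (0:ℝ) ≤ k := by linarith
  have hlh' : (l : ℝ) < h := by exact_mod_cast hlh
  -- geometry: d = h − l, N = T − 2l, A = T − T₀ ≤ m = t1 r + t2 (r+k)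
  obtain ⟨d, hd⟩ : ∃ d : ℝ, d = (h : ℝ) - l := ⟨_, rfl⟩
  have hd0 : 0 < d := by rw [hd]; linarith
  obtain ⟨N, hN⟩ : ∃ N : ℝ, N = T - 2 * (l : ℝ) := ⟨_, rfl⟩
  have hA : T - T₀ = a * (q * ((r : ℝ) + k * g)) := by rw [hT, hT₀]; ring
  have em : q * (1 - g) * (r : ℝ) + q * g * ((r : ℝ) + k) = q * ((r : ℝ) + k * g) := by ring
  have hAm : T - T₀ ≤ t1 * r + t2 * ((r : ℝ) + k) := by
    rw [hA, ht1, ht2]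
    have h1 : a * (q * ((r : ℝ) + k * g)) ≤ 1 * (q * ((r : ℝ) + k * g)) :=
      mul_le_mul_of_nonneg_right ha1 (by positivity)
    linarith [h1, em]
  have hA0 : 0 ≤ T - T₀ := by rw [hA]; positivity
  have hN0 : 0 < N := by rw [hN, hT]; linarith
  have hNK : N < (r : ℝ) + k := by rw [hN, hT]; linarith              -- row l compatible with A
  have hNy : N ≤ y * d := by rw [hN, hd, hT, hy]; exact hlightT      -- light at T
  have hNd : N < d := lt_of_le_of_lt hNy ((mul_lt_iff_lt_one_left hd0).mpr hy1)
  have h2rN : 2 * (r : ℝ) < N := by rw [hN, hT]; linarith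
  -- y (r+k) ≤ a m ≤ N: the bottom copy is HEAVY for the top copy (automatic in the band)
  have hxq : x ≤ q := le_trans hxqg (by nlinarith)
  have hxK : x * ((r : ℝ) + k) ≤ q * ((r : ℝ) + k * g) := by
    have e1 : x * (r : ℝ) ≤ q * r := mul_le_mul_of_nonneg_right hxq hr0
    have e2 : x * (k : ℝ) ≤ q * g * k := mul_le_mul_of_nonneg_right hxqg hk0
    linarith [e1, e2]
  have hyK : y * ((r : ℝ) + k) ≤ N := by
    have e1 : y * ((r : ℝ) + k) ≤ T - T₀ := by
      rw [hy, hA, mul_assoc]; exact mul_le_mul_of_nonneg_left hxK ha0.le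
    rw [hN]; rw [hT₀] at e1; linarith
  -- the light gate of the first factor
  obtain ⟨ρ₀, hρ₀⟩ : ∃ ρ₀ : ℝ, ρ₀ = (T₀ - 2 * (l : ℝ)) / ((h : ℝ) - l) := ⟨_, rfl⟩
  have hρ₀y : ρ₀ < y := by
    have : (T₀ - 2 * (l : ℝ)) / ((h : ℝ) - l) ≤ pairGate y T₀ l h := le_max_left _ _
    rw [hρ₀]; rw [hy, hT₀] at this ⊢; linarith
  obtain ⟨γ, hγ⟩ : ∃ γ : ℝ, γ = y ^ 2 + (1 - y) * ρ₀ := ⟨_, rfl⟩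
  have hγ' : pairGate (a * x) (a * S) l h = γ := by
    rw [hγ, hρ₀, hT₀, hy]; exact pairGate_eq_light (a * x) (a * S) l h (mul_pos ha0 hx0).le (by rw [← hy, ← hT₀, ← hρ₀]; exact hρ₀y.le)
  have eρ₀ : ρ₀ = (N - (T - T₀)) / d := by rw [hρ₀, hN, hd]; congr 1; ring
  have hρ₀0 : 0 < ρ₀ := by rw [hρ₀]; exact div_pos (by rw [hT₀]; linarith) (by linarith)
  -- credit ratios of the two rows into h at T
  obtain ⟨ρa, hρa⟩ : ∃ ρa : ℝ, ρa = N / d := ⟨_, rfl⟩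
  obtain ⟨ρb, hρb⟩ : ∃ ρb : ℝ, ρb = (N - 2 * (r : ℝ)) / (d - r) := ⟨_, rfl⟩
  have hdr : 0 < d - r := by linarith
  have hρay : ρa ≤ y := by rw [hρa, div_le_iff₀ hd0]; linarith
  have hρa0 : 0 < ρa := by rw [hρa]; exact div_pos (by linarith) hd0
  have hρb0 : 0 < ρb := by rw [hρb]; exact div_pos (by linarith) hdr
  have hN2d : N ≤ 2 * d := by rw [hN, hd, hT]; linarith
  have hρba : ρb ≤ ρa := by
    rw [hρa, hρb, div_le_div_iff₀ hdr hd0]; linarith [mul_le_mul_of_nonneg_left hN2d hr0]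
  have hρby : ρb ≤ y := le_trans hρba hρay
  -- exact light powers into h
  obtain ⟨Ga, hGa⟩ : ∃ Ga : ℝ, Ga = y ^ 2 + (1 - y) * ρa := ⟨_, rfl⟩
  obtain ⟨Gb, hGb⟩ : ∃ Gb : ℝ, Gb = y ^ 2 + (1 - y) * ρb := ⟨_, rfl⟩
  have hGa0 : 0 < Ga := by rw [hGa]; exact add_pos_of_pos_of_nonneg (pow_pos hy0 2) (mul_nonneg h1y.le hρa0.le)
  have hGb0 : 0 < Gb := by rw [hGb]; exact add_pos_of_pos_of_nonneg (pow_pos hy0 2) (mul_nonneg h1y.le hρb0.le)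
  have hGa1 : 0 < 1 - Ga := by
    rw [hGa, show 1 - (y ^ 2 + (1 - y) * ρa) = (1 - y) * (1 + y - ρa) by ring]; exact mul_pos h1y (by linarith)
  have hGb1 : 0 < 1 - Gb := by
    rw [hGb, show 1 - (y ^ 2 + (1 - y) * ρb) = (1 - y) * (1 + y - ρb) by ring]; exact mul_pos h1y (by linarith)
  obtain ⟨ϖa, hϖa⟩ : ∃ ϖa : ℝ, ϖa = (1 - Ga) / Ga := ⟨_, rfl⟩
  obtain ⟨ϖb, hϖb⟩ : ∃ ϖb : ℝ, ϖb = (1 - Gb) / Gb := ⟨_, rfl⟩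
  have hϖa0 : 0 < ϖa := by rw [hϖa]; exact div_pos hGa1 hGa0
  have hϖb0 : 0 < ϖb := by rw [hϖb]; exact div_pos hGb1 hGb0
  -- validity into h (exact light rate), into h + r (nearer-to-farther), and compatibility
  have hcompa : T < (l : ℝ) + h := by rw [hN, hd] at hNd; linarith
  have hcompb : T < ((l : ℝ) + r) + h := by
    have : N - (r : ℝ) < d := by linarith
    rw [hN, hd] at this; linarith
  have eLr : ((l + r : ℕ) : ℝ) = (l : ℝ) + r := by push_cast; ring
  have eL2 : ((l + r + k : ℕ) : ℝ) = (l : ℝ) + r + k := by push_cast; ring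
  have vaH : ϖa * usage y T j l h ≤ 1 := by
    have hρ : (T - 2 * (l : ℝ)) / ((h : ℝ) - l) ≤ y := by rw [← hN, ← hd, ← hρa]; exact hρay
    rw [usage_light_eq y T j l h hy0.le hhj hρ, ← hN, ← hd, ← hρa, ← hGa, hϖa, div_mul_div_comm, mul_comm (1 - Ga) Ga,
      div_self (mul_ne_zero hGa0.ne' hGa1.ne')]
  have vbH : ϖb * usage y T j (l + r) h ≤ 1 := by
    have e1 : (T - 2 * ((l + r : ℕ) : ℝ)) / ((h : ℝ) - ((l + r : ℕ) : ℝ)) = ρb := by rw [hρb, hN, hd, eLr]; ring_nf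
    have hρ : (T - 2 * ((l + r : ℕ) : ℝ)) / ((h : ℝ) - ((l + r : ℕ) : ℝ)) ≤ y := by rw [e1]; exact hρby
    rw [usage_light_eq y T j (l + r) h hy0.le hhj hρ, e1, ← hGb, hϖb, div_mul_div_comm, mul_comm (1 - Gb) Gb,
      div_self (mul_ne_zero hGb0.ne' hGb1.ne')]
  have hlowl : 2 * (l : ℝ) < T := by linarith
  have hlowlr : 2 * ((l + r : ℕ) : ℝ) < T := by rw [eLr]; linarith
  have vaG : ϖa * usage y T j l (h + r) ≤ 1 ∨ j < h + r := by
    by_cases hjr : h + r ≤ j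
    · exact Or.inl (le_trans (mul_le_mul_of_nonneg_left (usage_anti_mid y T j l h (h + r) hy0 hy1 (by omega) hjr hlowl hcompa) hϖa0.le) vaH)
    · exact Or.inr (by omega)
  have vbG : ϖb * usage y T j (l + r) (h + r) ≤ 1 ∨ j < h + r := by
    by_cases hjr : h + r ≤ j
    · refine Or.inl (le_trans (mul_le_mul_of_nonneg_left (usage_anti_mid y T j (l + r) h (h + r) hy0 hy1 (by omega) hjr hlowlr ?_) hϖb0.le) vbH)
      rw [eLr]; exact hcompb
    · exact Or.inr (by omega)
  -- the top copy A = l + r + k: exact heavy power for row l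
  obtain ⟨ϖA, hϖA⟩ : ∃ ϖA : ℝ, ϖA = ((l : ℝ) + ((l + r + k : ℕ) : ℝ) - T) / (T - 2 * (l : ℝ)) := ⟨_, rfl⟩
  have hAcomp' : T < (l : ℝ) + ((l + r + k : ℕ) : ℝ) := by rw [eL2]; rw [hN] at hNK; linarith
  have hAheavy : y * ((((l + r + k : ℕ) : ℝ)) - l) ≤ T - 2 * (l : ℝ) := by rw [eL2, ← hN]; linarith [hyK]
  have vA : ϖA * usage y T j l (l + r + k) ≤ 1 := by
    have e := GluedWindow.apow_heavy_valid y T 1 j l (l + r + k) hy0 hy1 hL2j hlowl hAcomp' hAheavy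
    rw [← hϖA, one_mul] at e
    exact e.le
  have eϖA : ϖA = ((r : ℝ) + k - N) / N := by rw [hϖA, eL2, hN]; congr 1; ring
  have hϖA0 : 0 ≤ ϖA := by rw [eϖA]; exact div_nonneg (by linarith) hN0.le
  have hϖApos : 0 < ϖA := by rw [eϖA]; exact div_pos (by linarith) hN0
  -- the top copy for row l + r: LIGHT; inverse-rate bound ϖB = (1−y)/G_A
  obtain ⟨ρA, hρA⟩ : ∃ ρA : ℝ, ρA = (T - 2 * ((l + r : ℕ) : ℝ)) / ((((l + r + k : ℕ) : ℝ)) - ((l + r : ℕ) : ℝ)) := ⟨_, rfl⟩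
  have eρA : ρA = (N - 2 * (r : ℝ)) / k := by rw [hρA, eL2, eLr, hN]; congr 1 <;> ring
  have hk0' : (0:ℝ) < k := by linarith
  have hρAy : ρA ≤ y := by rw [eρA, div_le_iff₀ hk0', hN, hT, hy]; linarith [hBlight]
  have hρA0 : 0 ≤ ρA := by rw [eρA]; exact div_nonneg (by linarith) hk0'.le
  obtain ⟨GA, hGA⟩ : ∃ GA : ℝ, GA = y ^ 2 + (1 - y) * ρA := ⟨_, rfl⟩
  have hGAy : GA ≤ y := by rw [hGA]; nlinarith [mul_le_mul_of_nonneg_left hρAy h1y.le]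
  have hGA0 : 0 < GA := by rw [hGA]; exact add_pos_of_pos_of_nonneg (pow_pos hy0 2) (mul_nonneg h1y.le hρA0)
  have hGA1 : 0 < 1 - GA := by linarith
  obtain ⟨ϖB, hϖB⟩ : ∃ ϖB : ℝ, ϖB = (1 - GA) / GA := ⟨_, rfl⟩
  have hϖBpos : 0 < ϖB := by rw [hϖB]; exact div_pos hGA1 hGA0
  have hϖBge : (1 - y) / y ≤ ϖB := by rw [hϖB, div_le_div_iff₀ hy0 hGA0]; nlinarith [hGAy]
  have vB : ϖB * usage y T j (l + r) (l + r + k) ≤ 1 := by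
    rw [usage_light_eq y T j (l + r) (l + r + k) hy0.le hL2j (by rw [← hρA]; exact hρAy), ← hρA, ← hGA, hϖB, div_mul_div_comm,
      mul_comm (1 - GA) GA, div_self (mul_ne_zero hGA0.ne' hGA1.ne')]
  have hBcomp' : T < ((l + r : ℕ) : ℝ) + ((l + r + k : ℕ) : ℝ) := by rw [eLr, eL2]; rw [hN] at hNK; linarith
  -- row l+r always fits into A: t1 ≤ t2 ϖB; its share θ = t1/(t2 ϖB)
  have ht2pos : 0 < t2 := lt_of_lt_of_le hy0 hyt2
  have ht2ϖB : 0 < t2 * ϖB := mul_pos ht2pos hϖBpos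
  have hfit : t1 ≤ t2 * ϖB := by
    have h1 : 1 - y ≤ t2 * ϖB := by
      calc 1 - y = y * ((1 - y) / y) := by field_simp
        _ ≤ t2 * ϖB := mul_le_mul hyt2 hϖBge (div_nonneg h1y.le hy0.le) ht2p
    linarith
  obtain ⟨θ, hθ⟩ : ∃ θ : ℝ, θ = t1 / (t2 * ϖB) := ⟨_, rfl⟩
  have hθ0 : 0 ≤ θ := by rw [hθ]; exact div_nonneg ht1p ht2ϖB.le
  have hθ1 : θ ≤ 1 := by rw [hθ, div_le_one ht2ϖB]; exact hfit
  have hθc : θ * (t2 * ϖB) = t1 := by rw [hθ]; exact div_mul_cancel₀ _ ht2ϖB.ne'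
  -- the main inequality (1−γ)(t0 − (1−θ) t2 ϖA) ≤ γ ϖa via (★L)
  obtain ⟨cc, hcc⟩ : ∃ cc : ℝ, cc = 1 + y - ρa := ⟨_, rfl⟩
  obtain ⟨ee, hee⟩ : ∃ ee : ℝ, ee = (r : ℝ) / d := ⟨_, rfl⟩
  obtain ⟨kk, hkk⟩ : ∃ kk : ℝ, kk = ((r : ℝ) + k) / d := ⟨_, rfl⟩
  obtain ⟨aa, haa⟩ : ∃ aa : ℝ, aa = (T - T₀) / d := ⟨_, rfl⟩
  have enu : 1 + y - cc = ρa := by rw [hcc]; ring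
  have hcc1 : 1 ≤ cc := by rw [hcc]; linarith
  have hccy : cc < 1 + y := by rw [hcc]; linarith
  have hee0 : 0 ≤ ee := by rw [hee]; positivity
  have haa0 : 0 ≤ aa := by rw [haa]; positivity
  have hn0 : 0 < 1 + y - cc := by linarith
  have hee1 : 2 * ee ≤ 1 + y - cc := by
    rw [hee, enu, hρa, show 2 * ((r : ℝ) / d) = (2 * r) / d by ring, div_le_div_iff₀ hd0 hd0]
    exact mul_le_mul_of_nonneg_right (by linarith) hd0.le
  have hkky : y * kk ≤ 1 + y - cc := by
    rw [hkk, enu, hρa, ← mul_div_assoc]; exact div_le_div_of_nonneg_right hyK hd0.le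
  have hkkn : 1 + y - cc < kk := by rw [hkk, enu, hρa]; exact div_lt_div_of_pos_right hNK hd0
  have hBl : (1 + y - cc) - 2 * ee ≤ y * (kk - ee) := by
    rw [enu, hρa, hee, hkk]
    have e1 : N / d - 2 * ((r : ℝ) / d) = (N - 2 * r) / d := by ring
    have e2 : y * (((r : ℝ) + k) / d - (r : ℝ) / d) = (y * k) / d := by ring
    rw [e1, e2]
    exact div_le_div_of_nonneg_right (by rw [hy, hN, hT]; linarith [hBlight]) hd0.le
  have eϖA' : ϖA = (kk - (1 + y - cc)) / (1 + y - cc) := by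
    rw [eϖA, enu, hkk, hρa, ← sub_div, div_div_div_cancel_right₀ hd0.ne']
  have eρA' : ρA = ((1 + y - cc) - 2 * ee) / (kk - ee) := by
    rw [eρA, enu, hkk, hee, hρa, ← sub_div, show N / d - 2 * ((r : ℝ) / d) = (N - 2 * r) / d by ring,
      show (r : ℝ) + k - r = k by ring, div_div_div_cancel_right₀ hd0.ne']
  have haamax : aa ≤ t1 * ee + t2 * kk := by
    rw [haa, hee, hkk, show t1 * ((r : ℝ) / d) + t2 * (((r : ℝ) + k) / d) = (t1 * r + t2 * ((r : ℝ) + k)) / d by ring]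
    exact div_le_div_of_nonneg_right hAm hd0.le
  have hden : 0 < cc + t1 * ee + t2 * kk := by
    have a1 : 0 ≤ t1 * ee := mul_nonneg ht1p hee0
    have a3 : 0 ≤ t2 * kk := mul_nonneg ht2p (by linarith)
    linarith [a1, a3]
  obtain ⟨Y, hY⟩ : ∃ Y : ℝ, Y = (1 - t1 - t2) - (1 - θ) * t2 * ϖA := ⟨_, rfl⟩
  -- q-forms of the light powers into h, and the three ingredients: (★7′), the transfer, the comparative advantage
  obtain ⟨qc, hqcd⟩ : ∃ qc : ℝ, qc = 1 / cc - (1 - y) := ⟨_, rfl⟩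
  obtain ⟨q1, hq1d⟩ : ∃ q1 : ℝ, q1 = (1 - ee) / (cc + (1 - y) * ee) - (1 - y) := ⟨_, rfl⟩
  have L7 := lightInc_star y cc ee t1 t2 hy0 hyt2 ht1p ht0p hcc1 hccy.le hee0 hee1 hy1
  have ea : (1 - t1 - t2) / cc = (1 - t1 - t2) * qc + (1 - t1 - t2) * (1 - y) := by rw [hqcd]; ring
  have eb : t1 * (1 - ee) / (cc + (1 - y) * ee) = t1 * q1 + t1 * (1 - y) := by rw [hq1d]; ring
  rw [ea, eb] at L7
  have tr := topTransfer y t1 t2 cc ee kk hy0 hy1 ht1p ht2p hcc1 hccy hee0 hkkn.le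
  rw [← eϖA', ← hqcd] at tr
  have hee1' : 2 * ee < 1 + y - cc := by
    rw [hee, enu, hρa, show 2 * ((r : ℝ) / d) = (2 * r) / d by ring]; exact div_lt_div_of_pos_right (by linarith) hd0
  have CA := compAdv_light y cc ee kk ρA hy0 hy1 hcc1 hccy hee0 hee1' hkkn hkky hBl eρA'
  rw [← eϖA', ← hGA, ← hϖB, ← hqcd, ← hq1d] at CA
  have hY1 : Y * qc ≤ (1 - t1 - t2) * qc - t2 * ϖA * qc + t1 * q1 := by
    have h1 : θ * t2 * (ϖA * qc) ≤ θ * t2 * (ϖB * q1) := mul_le_mul_of_nonneg_left CA (mul_nonneg hθ0 ht2p)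
    have e1 : θ * t2 * (ϖB * q1) = θ * (t2 * ϖB) * q1 := by ring
    rw [e1, hθc] at h1
    have e2 : Y * qc = (1 - t1 - t2) * qc - t2 * ϖA * qc + θ * t2 * (ϖA * qc) := by rw [hY]; ring
    rw [e2]; linarith
  have hDk : 1 / (cc + t1 * ee + t2 * kk) ≤ 1 / (cc + aa) := by
    rw [one_div_le_one_div hden (by linarith)]; linarith
  -- Z-form, one-row instance of `lightOnly_main_of_star5` (t1 := 0)
  obtain ⟨Zb, hZb⟩ : ∃ Zb : ℝ, Zb = 1 + y - ρb := ⟨_, rfl⟩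
  have hZb0 : 0 < Zb := by rw [hZb]; linarith
  have eZ : 1 + y - ρ₀ = cc + aa := by rw [hcc, haa, eρ₀, hρa, sub_div]; ring
  have star5 : Y / cc + 0 / Zb + (1 - Y) * (1 - y) ≤ 1 / (1 + y - ρ₀) := by
    have e5 : Y / cc = Y * qc + Y * (1 - y) := by rw [hqcd]; ring
    rw [eZ, zero_div, add_zero, e5]
    linarith [L7, tr, hY1, hDk]
  have main' := lightOnly_main_of_star5 y (1 + y - ρ₀) cc Zb Y 0 (1 - Y) hy1 (by linarith) (by linarith) hZb0 (by ring) star5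
  have eϖa : (1 - y) * cc / (1 - (1 - y) * cc) = ϖa := by
    rw [hϖa, hGa, hcc]; congr 1 <;> ring
  have e1γ : (1 - y) * (1 + y - ρ₀) = 1 - γ := by rw [hγ]; ring
  rw [eϖa, e1γ, show 1 - (1 - γ) = γ by ring, zero_div, add_zero] at main'
  -- main' : (1 − γ) * (Y/ϖa) ≤ γ
  have hγ0 : 0 < γ := by rw [hγ]; exact add_pos_of_pos_of_nonneg (pow_pos hy0 2) (mul_pos h1y hρ₀0).le
  have h1γ : 0 < 1 - γ := by
    rw [hγ, show 1 - (y ^ 2 + (1 - y) * ρ₀) = (1 - y) * (1 + y - ρ₀) by ring]; exact mul_pos h1y (by linarith)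
  have cov0' : (1 - γ) * (1 - t1 - t2) ≤ (1 - θ) * ((1 - γ) * t2 * ϖA) + γ * ϖa := by
    have h2 : (1 - γ) * Y ≤ γ * ϖa := by
      have := mul_le_mul_of_nonneg_right main' hϖa0.le
      rwa [mul_assoc, div_mul_cancel₀ _ hϖa0.ne'] at this
    rw [hY] at h2; linarith
  have et0 : 1 - t1 - t2 = 1 - q := by rw [ht1, ht2]; ring
  have h1θ : 0 ≤ 1 - θ := by linarith
  have vB' := vB
  -- apply the reduction theorem (shares: row l ↦ 1−θ of A and every copy of h; row l+r ↦ θ of A only)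
  by_cases hjr : h + r ≤ j
  · have vaG' : ϖa * usage y T j l (h + r) ≤ 1 := by rcases vaG with h1 | h1; exacts [h1, absurd hjr (by omega)]
    refine gluedPullback_windowPair_twoRow_mid_of_assign x a q g S B r k j l h c ls α p 0 ϖA ϖa ϖa ϖa ϖB 0 0 0
      (1 - θ) 1 1 1 θ 0 0 0
      hx0 hx1 ha0 ha1 hq0 hq1 hg0 hg1 hr hlh hhB hwin hlow hcomp hL2j hL2mid hL1low hhmid (Or.inl ⟨hjr, rfl⟩) hhc hcB hcj hp hαp hcheap
      hϖA0 hϖa0.le hϖa0.le hϖa0.le hϖBpos.le le_rfl le_rfl le_rfl h1θ zero_le_one zero_le_one zero_le_one hθ0 le_rfl le_rfl le_rfl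
      (by linarith) (by linarith) (by linarith) (by linarith)
      ?_ (Or.inr ?_) ?_ (Or.inr ?_) ?_ (Or.inr (Or.inr ?_)) (Or.inr ⟨?_, ?_⟩)
      ?_ (Or.inr ?_) ?_ (Or.inl rfl) ?_ (Or.inl rfl) (Or.inl ?_) ?_ ?_
    · rw [← hy, ← hT]; exact vA
    · rw [← hT, ← eL2]; exact hAcomp'
    · rw [← hy, ← hT]; exact vaH
    · rw [← hT]; exact hcompa
    · rw [← hy, ← hT]; exact vaG'
    · rw [← hT]; linarith
    · rw [← hT]; exact hcompa
    · rw [← hy, ← hT]; exact vaH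
    · rw [← hy, ← hT]; exact vB'
    · rw [← hT, ← eL2, ← eLr]; exact hBcomp'
    · rw [zero_mul]; exact zero_le_one
    · rw [zero_mul]; exact zero_le_one
    · rw [zero_mul]; exact zero_le_one
    · rw [hγ', ← ht1, ← ht2, ← et0]
      have e : (1 - θ) * ((1 - γ) * t2 * ϖA) + 1 * (γ * (1 - t1 - t2) * ϖa) + 1 * (γ * t1 * (1 - 0) * ϖa) + 1 * (γ * (t2 + 0 * t1) * ϖa)
          = (1 - θ) * ((1 - γ) * t2 * ϖA) + γ * ϖa := by ring
      rw [e]; exact cov0'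
    · rw [hγ', ← ht1, ← ht2]
      have e : θ * ((1 - γ) * t2 * ϖB) + 0 * (γ * (1 - q) * 0) + 0 * (γ * t1 * (1 - 0) * 0) + 0 * (γ * (t2 + 0 * t1) * 0)
          = θ * (t2 * ϖB) * (1 - γ) := by ring
      rw [e, hθc, mul_comm]
  · have hjr' : j < h + r := by omega
    refine gluedPullback_windowPair_twoRow_mid_of_assign x a q g S B r k j l h c ls α p 1 ϖA ϖa 0 ϖa ϖB 0 0 0
      (1 - θ) 1 1 1 θ 0 0 0
      hx0 hx1 ha0 ha1 hq0 hq1 hg0 hg1 hr hlh hhB hwin hlow hcomp hL2j hL2mid hL1low hhmid (Or.inr ⟨hjr', rfl⟩) hhc hcB hcj hp hαp hcheap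
      hϖA0 hϖa0.le le_rfl hϖa0.le hϖBpos.le le_rfl le_rfl le_rfl h1θ zero_le_one zero_le_one zero_le_one hθ0 le_rfl le_rfl le_rfl
      (by linarith) (by linarith) (by linarith) (by linarith)
      ?_ (Or.inr ?_) ?_ (Or.inr ?_) ?_ (Or.inl rfl) (Or.inr ⟨?_, ?_⟩)
      ?_ (Or.inr ?_) ?_ (Or.inl rfl) ?_ (Or.inl rfl) (Or.inl ?_) ?_ ?_
    · rw [← hy, ← hT]; exact vA
    · rw [← hT, ← eL2]; exact hAcomp'
    · rw [← hy, ← hT]; exact vaH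
    · rw [← hT]; exact hcompa
    · rw [zero_mul]; exact zero_le_one
    · rw [← hT]; exact hcompa
    · rw [← hy, ← hT]; exact vaH
    · rw [← hy, ← hT]; exact vB'
    · rw [← hT, ← eL2, ← eLr]; exact hBcomp'
    · rw [zero_mul]; exact zero_le_one
    · rw [zero_mul]; exact zero_le_one
    · rw [zero_mul]; exact zero_le_one
    · rw [hγ', ← ht1, ← ht2, ← et0]
      have e : (1 - θ) * ((1 - γ) * t2 * ϖA) + 1 * (γ * (1 - t1 - t2) * ϖa) + 1 * (γ * t1 * (1 - 1) * 0) + 1 * (γ * (t2 + 1 * t1) * ϖa)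
          = (1 - θ) * ((1 - γ) * t2 * ϖA) + γ * ϖa := by ring
      rw [e]; exact cov0'
    · rw [hγ', ← ht1, ← ht2]
      have e : θ * ((1 - γ) * t2 * ϖB) + 0 * (γ * (1 - q) * 0) + 0 * (γ * t1 * (1 - 1) * 0) + 0 * (γ * (t2 + 1 * t1) * 0)
          = θ * (t2 * ϖB) * (1 - γ) := by ring
      rw [e, hθc, mul_comm]

end LawDec
end Quant
end Summit.CriticalPhenomena.PercolationContinuityZ3.Theorems
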